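import Summits.BirchSwinnertonDyer.BirchSwinnertonDyer.Theorems.UniversalToricDescentUnramifiedLocalCount
import Summits.BirchSwinnertonDyer.BirchSwinnertonDyer.Theorems.UniversalToricDescentSigmaLocalFinite
import Literature.NumberTheory.EllipticCurves.FineSelmerTorsionCoefficientsFiniteProofs
import Literature.NumberTheory.GaloisRepresentations.GaloisCohomologyLocalizationTransport
import HarnessLib

/-!
# Route UniversalToricDescent — Greenberg–Vatsal Prop. (2.4) at a place of GOOD reduction:
# the local term of 21845's algebraic half, `#H¹(K_{∞,w}, E[p^∞])[p] = #{P ∈ E[p] : φ^{p^R} P = q_v^{p^R} P}`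

Lead prover bsd-wall-utd-p1 g9 (`--supports stmt-BirchSwinnertonDyer-20399`; closes memo
ALG-HALF-21845-LOCAL §5's "VALUE of `s_v`" at every place of `Σ` where the curve in question has GOOD
reduction — recall `Σ` = places `v ∤ 3` where `E_K` OR `E′_K` is bad, so at each `v ∈ Σ` at least one of
the two congruent curves is typically good). For a number field `K`, `E = W/K` elliptic, a prime `p`, a
`ℤ_p`-extension `κ` (`H = ker κ`), a place `v ∤ p` finitely decomposed in `K_∞` (`D_v ⊄ H`) of good
reduction, and an arithmetic Frobenius `φ` of `K_v`:

* `exists_fixed_and_nsmul_eq_of_hasGoodReductionAt` — **`E(K_{∞,w})[p^∞]` is `p`-divisible** for EVERY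
  `ℤ_p`-extension at a finitely decomposed good `v ∤ p` (the tree's cyclotomic
  `ZpExtension.IsCyclotomic.exists_fixed_and_nsmul_eq_of_hasGoodReductionAt`, Greenberg LNM 1716 §3
  "`B_v` is divisible", generalised): the image of `Gal(K̄_v/K_{∞,w})` in `Aut E[p^{k+1}]` factors through
  the pro-prime-to-`p` group `Gal(K̄_v/K_{∞,w})/I` (`coprime_index_of_quotient_localSubgroup_absInertia`),
  so averaging a `p`-th root over it (order `d` prime to `p`, Bézout) gives an invariant `p`-th root.
* **`exists_forall_natCard_pTorsion_subgroupH1_kerD_eq`** — in the currency of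
  `invariantsTransportT_algebraicHalf_lambda` (`#H¹(kerD κ v, E[p^∞])[p] = p^{s_v}`): there is `R₀` with,
  for all `R ≥ R₀`, **`#{f ∈ H¹(kerD κ v, E[p^∞]) : p f = 0} = #{P ∈ E[p] : res(φ)^{p^R} • P = q_v^{p^R} • P}`**.
  Chain: `kerD κ v ≅ H ⊓ D_v` (two inflations) · Kummer `H¹(·, E[p]) ⥲ H¹(·, E[p^∞])[p]`
  (`torsionToPrimaryH1Sub`, injective by the divisibility above) · `H ⊓ D_v = res Gal(K̄_v/K_{∞,w})`
  (two inflations, `absGaloisRangeEquivCompletion`) · `exists_forall_natCard_subgroupH1_localSubgroup_eq`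
  (p593117) for the unramified module `E[p]` (Silverman VII.4.1).

So at a good `v ∈ Σ`: `s_v = dim_{𝔽_p} ker((q_v⁻¹ρ(φ))^{p^R} − 1 | E[p])`, the multiplicity of the
eigenvalue `q_v` of Frobenius on `E[p]` — Greenberg–Vatsal's `d_v`. THEOREMS ONLY; no definition, no
named fact, no `sorry`. BSD is not advanced by this file.
References: [GreenbergVatsal2000] §2 Prop. (2.4) (p. 22); [GreenbergLNM1716] §3 Lemma 3.3 (proof,
p. 87); [SilvermanAEC2009] VII.4.1; [NeukirchANT1999] II (9.6).
-/

set_option autoImplicit false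
-- `…BirchSwinnertonDyer.BirchSwinnertonDyer.Theorems…` is the problem's mandated namespace (D-0017).
set_option linter.dupNamespace false

noncomputable section

open scoped Classical AddSubgroup

namespace Summit.BirchSwinnertonDyer.BirchSwinnertonDyer.Theorems.UniversalToricDescentGoodLocalTerm

open Function NumberField IsDedekindDomain Field ValuativeRel WeierstrassCurve
open Literature.NumberTheory.EllipticCurves Literature.NumberTheory.EllipticCurves.GreenbergSelmer
  Literature.NumberTheory.GaloisRepresentations
  Literature.NumberTheory.GaloisRepresentations.IsNonarchimedeanLocalField
  IsDedekindDomain.HeightOneSpectrum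
  Summit.BirchSwinnertonDyer.Rank1Residual.X11b Summit.BirchSwinnertonDyer.Rank1Residual.X11b.Coinv
  Summit.BirchSwinnertonDyer.Rank1Residual.Iwasawa
  Summit.BirchSwinnertonDyer.BirchSwinnertonDyer.Theorems.UniversalToricDescentSigmaPassage
  Summit.BirchSwinnertonDyer.BirchSwinnertonDyer.Theorems.UniversalToricDescentSigmaLocalImage
  Summit.BirchSwinnertonDyer.BirchSwinnertonDyer.Theorems.UniversalToricDescentProPrimeToP
  Summit.BirchSwinnertonDyer.BirchSwinnertonDyer.Theorems.UniversalToricDescentLocalH1Count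
  Summit.BirchSwinnertonDyer.BirchSwinnertonDyer.Theorems.UniversalToricDescentUnramifiedLocalCount

variable {K : Type} [Field K] [NumberField K] (W : WeierstrassCurve K) [W.IsElliptic] {p : ℕ}
  [Fact p.Prime] (κ : ZpExtension K p) {v : HeightOneSpectrum (𝓞 K)}

/-! ### §1 `E(K_{∞,w})[p^∞]` is `p`-divisible at a finitely decomposed good place `v ∤ p` -/

omit [Fact p.Prime] in
/-- Local inertia fixes `E[p^∞]`-points of `p`-power order at a good `v ∤ p` (Silverman VII.4.1(a),
through `I_{𝔓₀} = res I_{K_v}`, `inertia_adicCompletionPrime_eq_map_absInertia`). [cite: SilvermanAEC2009, Prop. VII.4.1(a)] -/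
theorem absGaloisRestrict_smul_eq_of_mem_absInertia (hpv : (p : 𝓞 K) ∉ v.asIdeal)
    (hv : W.HasGoodReductionAt v) {τ : absoluteGaloisGroup (v.adicCompletion K)}
    (hτ : τ ∈ absInertia (v.adicCompletion K)) (t : W.geomPrimaryTorsion p) :
    absGaloisRestrict K (v.adicCompletion K) τ • t = t := by
  obtain ⟨k, hk⟩ := t.2
  have hτ' : absGaloisRestrict K (v.adicCompletion K) τ ∈
      (adicCompletionPrime K v).inertia (absoluteGaloisGroup K) := by
    rw [inertia_adicCompletionPrime_eq_map_absInertia]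
    exact Subgroup.mem_map_of_mem _ hτ
  apply Subtype.ext
  rw [primaryComponent.coe_smul]
  exact W.smul_eq_of_mem_inertia_of_nsmul_eq_zero hv (v.natCast_pow_not_mem hpv k)
    (adicCompletionPrime_mem_primesAbove K v) hτ' hk

/-- **`E(K_{∞,w})[p^∞]` is `p`-divisible at a place `v ∤ p` of good reduction finitely decomposed in
the `ℤ_p`-extension** (any `κ`; the tree's cyclotomic case is
`ZpExtension.IsCyclotomic.exists_fixed_and_nsmul_eq_of_hasGoodReductionAt`): every point of `E[p^∞]`
fixed by `Gal(K̄_v/K_{∞,w})` (acting through `res`) is `p` times such a point. Proof: a `p`-th root `b₀`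
of `a` lies in the finite `E[p^{k+1}]`, fixed by inertia; the stabiliser `V` of `E[p^{k+1}]` in
`Hi = Gal(K̄_v/K_{∞,w})` is open of index `d` prime to `p` (`Hi/I` is pro-prime-to-`p`), and the average
of the `Hi/V`-orbit of `b₀`, rescaled by `d⁻¹ (mod p^{k+1})`, is an invariant `p`-th root of `a`.
[cite: GreenbergLNM1716, §3 Lemma 3.3 (proof, p. 87: "B_v is divisible")] [cite: GreenbergVatsal2000, §2 Prop. (2.4)] -/
theorem exists_fixed_and_nsmul_eq_of_hasGoodReductionAt (hpv : (p : 𝓞 K) ∉ v.asIdeal)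
    (hns : ∃ σ : absoluteGaloisGroup (v.adicCompletion K),
      σ ∉ localSubgroup κ.kerSubgroup (v.adicCompletion K))
    (hv : W.HasGoodReductionAt v) {a : W.geomPrimaryTorsion p}
    (ha : ∀ h ∈ localSubgroup κ.kerSubgroup (v.adicCompletion K),
      absGaloisRestrict K (v.adicCompletion K) h • a = a) :
    ∃ b : W.geomPrimaryTorsion p,
      (∀ h ∈ localSubgroup κ.kerSubgroup (v.adicCompletion K),
        absGaloisRestrict K (v.adicCompletion K) h • b = b) ∧ p • b = a := by
  -- notation
  let Fv := v.adicCompletion K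
  let G : Type := absoluteGaloisGroup Fv
  let Hi : Subgroup G := localSubgroup κ.kerSubgroup Fv
  let I : Subgroup G := absInertia Fv
  let N : Subgroup Hi := I.subgroupOf Hi
  let r : G →ₜ* absoluteGaloisGroup K := absGaloisRestrict K Fv
  haveI : CharZero Fv := charZero_of_injective_algebraMap (algebraMap K Fv).injective
  haveI := absoluteGaloisGroup_compactSpace Fv
  have hp : (p : ℕ).Prime := Fact.out
  have hle : I ≤ Hi := absInertia_le_localSubgroup κ hpv
  -- the order of `a` and a `p`-th root `b₀ ∈ E[p^{k+1}]`
  obtain ⟨k, hk⟩ : ∃ k : ℕ, p ^ k • a = 0 := by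
    obtain ⟨k, hk⟩ := a.2
    exact ⟨k, Subtype.ext (by rw [AddSubgroupClass.coe_nsmul]; exact hk)⟩
  obtain ⟨b₀, hb₀⟩ := W.exists_nsmul_eq_geomPrimaryTorsion p W.zsmul_geomPoints_surjective_holds a
  have hb₀k : p ^ (k + 1) • b₀ = 0 := by rw [pow_succ, mul_smul, hb₀, hk]
  -- `Hi` is compact
  have hHic : IsClosed (Hi : Set G) :=
    κ.isClosed_kerSubgroup.preimage (map_continuous (resGal (K := K) Fv))
  haveI : CompactSpace Hi := isCompact_iff_compactSpace.mp hHic.isCompact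
  -- the finite set `T = E[p^∞][p^{k+1}]` and its stabiliser `V ≤ Hi`
  let T : AddSubgroup (W.geomPrimaryTorsion p) := (W.geomPrimaryTorsion p)[(p ^ (k + 1) : ℕ)]
  haveI : Finite T := W.finite_torsionBy_geomPrimaryTorsion p (k + 1)
  have hb₀T : b₀ ∈ T := by rw [AddSubgroup.torsionBy.nsmul_iff]; exact hb₀k
  have hcont : ∀ t : W.geomPrimaryTorsion p, Continuous fun h : Hi ↦ r h • t := fun t ↦
    (W.continuous_smul_geomPrimaryTorsion p t).comp (r.continuous_toFun.comp continuous_subtype_val)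
  let V : Subgroup Hi :=
    { carrier := {h | ∀ t : T, r h • (t : W.geomPrimaryTorsion p) = t}
      one_mem' := fun t ↦ by
        show r (1 : Hi) • (t : W.geomPrimaryTorsion p) = t
        rw [Subgroup.coe_one, map_one, one_smul]
      mul_mem' := fun {x y} hx hy t ↦ by
        show r ((x : G) * y) • (t : W.geomPrimaryTorsion p) = t
        rw [map_mul, mul_smul, hy t, hx t]
      inv_mem' := fun {x} hx t ↦ by
        show r ((x : G)⁻¹) • (t : W.geomPrimaryTorsion p) = t
        rw [map_inv, inv_smul_eq_iff, hx t] }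
  have hV : ∀ h : Hi, h ∈ V ↔ ∀ t : T, r h • (t : W.geomPrimaryTorsion p) = t := fun _ ↦ Iff.rfl
  have hVopen : IsOpen (V : Set Hi) := by
    have : (V : Set Hi) = ⋂ t : T, {h : Hi | r h • (t : W.geomPrimaryTorsion p) = t} := by
      ext h
      simp only [SetLike.mem_coe, hV, Set.mem_iInter, Set.mem_setOf_eq]
    rw [this]
    exact isOpen_iInter_of_finite fun t ↦ (isOpen_discrete {(t : W.geomPrimaryTorsion p)}).preimage
      (hcont t)
  have hNV : N ≤ V := fun h hh t ↦
    absGaloisRestrict_smul_eq_of_mem_absInertia W hpv hv (Subgroup.mem_subgroupOf.mp hh) _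
  -- the index of `V` is prime to `p`
  haveI : Finite (Hi ⧸ V) := Subgroup.quotient_finite_of_isOpen V hVopen
  letI : Fintype (Hi ⧸ V) := Fintype.ofFinite _
  set d : ℕ := Fintype.card (Hi ⧸ V) with hd
  have hdcop : d.Coprime p := by
    let U : Subgroup (Hi ⧸ N) := V.map (QuotientGroup.mk' N)
    have hU : IsOpen (U : Set (Hi ⧸ N)) := by
      show IsOpen ((V.map (QuotientGroup.mk' N) : Subgroup (Hi ⧸ N)) : Set (Hi ⧸ N))
      rw [Subgroup.coe_map]
      exact QuotientGroup.isOpenMap_coe _ hVopen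
    have hUidx : U.index = V.index := by
      show (V.map (QuotientGroup.mk' N)).index = V.index
      rw [Subgroup.index_map, QuotientGroup.ker_mk', sup_eq_left.mpr hNV,
        MonoidHom.range_eq_top.mpr (QuotientGroup.mk'_surjective N), Subgroup.index_top, mul_one]
    have h := coprime_index_of_quotient_localSubgroup_absInertia κ hpv hns U hU
    rwa [hUidx, Subgroup.index_eq_card, Nat.card_eq_fintype_card] at h
  -- averaging over `Hi / V`
  have hwfix : ∀ w : V, r ((w : Hi) : G) • b₀ = b₀ := fun w ↦ (hV _).mp w.2 ⟨b₀, hb₀T⟩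
  have hout : ∀ (h : Hi) (q : Hi ⧸ V), r ((h • q).out : Hi) • b₀ = r h • (r (q.out : Hi) • b₀) := by
    intro h q
    induction q using QuotientGroup.induction_on with
    | H x =>
      obtain ⟨w, hw⟩ := QuotientGroup.mk_out_eq_mul V x
      obtain ⟨w', hw'⟩ := QuotientGroup.mk_out_eq_mul V (h * x)
      rw [MulAction.Quotient.smul_mk, smul_eq_mul, hw', hw]
      simp only [Subgroup.coe_mul, map_mul, mul_smul, hwfix]
  let s : W.geomPrimaryTorsion p := ∑ q : Hi ⧸ V, r (q.out : Hi) • b₀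
  have hs_fix : ∀ h ∈ Hi, r h • s = s := by
    intro h hh
    have hsum : ∑ q : Hi ⧸ V, r (((⟨h, hh⟩ : Hi) • q).out : Hi) • b₀ = s :=
      Fintype.sum_equiv (MulAction.toPerm (⟨h, hh⟩ : Hi)) _ _ (fun q ↦ rfl)
    have hsum' : ∑ q : Hi ⧸ V, r h • (r (q.out : Hi) • b₀) = s := by
      rw [← hsum]
      exact Finset.sum_congr rfl fun q _ ↦ (hout ⟨h, hh⟩ q).symm
    rw [← Finset.smul_sum] at hsum'
    exact hsum'
  have hs_p : p • s = d • a := by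
    have hterm : ∀ q : Hi ⧸ V, p • (r (q.out : Hi) • b₀) = a := fun q ↦ by
      rw [smul_comm, hb₀]
      exact ha _ (q.out : Hi).2
    show p • (∑ q : Hi ⧸ V, r (q.out : Hi) • b₀) = d • a
    rw [Finset.smul_sum, Finset.sum_congr rfl fun q _ ↦ hterm q, Finset.sum_const, Finset.card_univ]
  -- Bézout
  obtain ⟨c, hc⟩ := exists_int_forall_eq_smul_nsmul (M := W.geomPrimaryTorsion p) hdcop (k + 1)
  have hka : p ^ (k + 1) • a = 0 := by rw [pow_succ', mul_smul, hk, smul_zero]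
  refine ⟨c • s, fun h hh ↦ by rw [smul_comm, hs_fix h hh], ?_⟩
  rw [smul_comm, hs_p, ← natCast_zsmul a d]
  exact (hc a hka).symm

/-! ### §2 The local term at a good place -/

/-- Two injections between finite sets give equal cardinalities (the `p`-torsion transport along a
pair of inverse inflations). [folklore] -/
theorem natCard_eq_of_injective_of_injective {α β : Type} [Finite α] [Finite β] {f : α → β}
    {g : β → α} (hf : Injective f) (hg : Injective g) : Nat.card α = Nat.card β :=
  le_antisymm (Nat.card_le_card_of_injective f hf) (Nat.card_le_card_of_injective g hg)

/-- **Greenberg–Vatsal Prop. (2.4) at a place of good reduction, in the currency of 21845's algebraic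
half** (`invariantsTransportT_algebraicHalf_lambda`: `#H¹(kerD κ v, E[p^∞])[p] = p^{s_v}`). For `E/K`
with good reduction at `v ∤ p`, `v` finitely decomposed in the `ℤ_p`-extension `κ` (`D_v ⊄ ker κ`), and
`φ` an arithmetic Frobenius of `K_v`: there is `R₀` with, for all `R ≥ R₀`,
**`#{f ∈ H¹(kerD κ v, E[p^∞]) : p • f = 0} = #{P ∈ E[p] : res(φ^{p^R}) • P = q_v^{p^R} • P}`**,
`q_v = residueFieldCard K_v`. Hence `s_v = dim_{𝔽_p}` of the fixed space of `(q_v⁻¹ Frob_v)^{p^R}` on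
`E[p]`, i.e. the multiplicity `d_v` of the eigenvalue `q_v` of Frobenius — the exponent of the Euler
factor `P_v(q_v⁻¹ γ_v)` in `λ(𝓛^Σ) − λ(𝓛)`. [cite: GreenbergVatsal2000, §2 Prop. (2.4) (p. 22)]
[cite: GreenbergLNM1716, §3 Lemma 3.3] [cite: SilvermanAEC2009, Prop. VII.4.1(a)] -/
theorem exists_forall_natCard_pTorsion_subgroupH1_kerD_eq (hpv : (p : 𝓞 K) ∉ v.asIdeal)
    (hD : ¬ (decomp v ≤ κ.kerSubgroup)) (hv : W.HasGoodReductionAt v)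
    {φ : absoluteGaloisGroup (v.adicCompletion K)} (hφ : IsFrobPow φ 1) :
    ∃ R₀ : ℕ, ∀ R : ℕ, R₀ ≤ R →
      Nat.card {f : Literature.NumberTheory.EllipticCurves.subgroupH1 (kerD κ v)
          (W.geomPrimaryTorsion p) // p • f = 0} =
        Nat.card {P : W.geomTorsion (p : ℤ) //
          absGaloisRestrict K (v.adicCompletion K) (φ ^ p ^ R) • P =
            (residueFieldCard (v.adicCompletion K) ^ p ^ R) • P} := by
  -- notation
  let Fv := v.adicCompletion K
  let G : Type := absoluteGaloisGroup Fv
  let Hi : Subgroup G := localSubgroup κ.kerSubgroup Fv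
  let D : Subgroup (absoluteGaloisGroup K) := κ.kerSubgroup ⊓ decomp v
  let A : Type := W.geomPrimaryTorsion p
  let B : Type := W.geomTorsion (p : ℤ)
  haveI : CharZero Fv := charZero_of_injective_algebraMap (algebraMap K Fv).injective
  have hp : (p : ℕ).Prime := Fact.out
  -- `v` not split completely: some `σ ∈ Γ_{K_v}` restricts outside `ker κ`
  have hns : ∃ σ : G, σ ∉ Hi := by
    by_contra hall
    refine hD fun g hg ↦ ?_
    obtain ⟨σ, rfl⟩ := (mem_decomp_iff v g).mp hg
    have hσ : σ ∈ Hi := not_not.mp fun h ↦ hall ⟨σ, h⟩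
    have h := (mem_localSubgroup_iff κ.kerSubgroup Fv σ).mp hσ
    rwa [resGal_eq_absGaloisRestrict] at h
  -- the two surjections `Hi ↠ D ↠ Hi`
  let θ₁ : Hi →ₜ* D :=
    { toFun := fun x ↦ ⟨absGaloisRestrict K Fv x, Subgroup.mem_inf.mpr ⟨by
          have h := (mem_localSubgroup_iff κ.kerSubgroup Fv x.1).mp x.2
          rwa [resGal_eq_absGaloisRestrict] at h, (mem_decomp_iff v _).mpr ⟨x, rfl⟩⟩⟩
      map_one' := Subtype.ext (by simp)
      map_mul' := fun x y ↦ Subtype.ext (by simp)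
      continuous_toFun :=
        ((absGaloisRestrict K Fv).continuous_toFun.comp continuous_subtype_val).subtype_mk _ }
  have hθ₁ : Surjective θ₁ := by
    rintro ⟨g, hg⟩
    obtain ⟨hgH, hgD⟩ := Subgroup.mem_inf.mp hg
    obtain ⟨σ, rfl⟩ := (mem_decomp_iff v g).mp hgD
    have hσ : σ ∈ Hi := by
      show σ ∈ localSubgroup κ.kerSubgroup Fv
      rw [mem_localSubgroup_iff, resGal_eq_absGaloisRestrict]; exact hgH
    exact ⟨⟨σ, hσ⟩, rfl⟩
  let e := absGaloisRangeEquivCompletion K v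
  have hDr : ∀ x : D, (x : absoluteGaloisGroup K) ∈ (absGaloisRestrict K Fv).range := fun x ↦
    (Subgroup.mem_inf.mp x.2).2
  have hmemHi : ∀ x : D, e.symm ⟨x.1, hDr x⟩ ∈ Hi := fun x ↦ by
    show e.symm ⟨x.1, hDr x⟩ ∈ localSubgroup κ.kerSubgroup Fv
    rw [mem_localSubgroup_iff, resGal_eq_absGaloisRestrict,
      absGaloisRestrict_absGaloisRangeEquivCompletion_symm]
    exact (Subgroup.mem_inf.mp x.2).1
  let θ₂ : D →ₜ* Hi :=
    { toFun := fun x ↦ ⟨e.symm ⟨x.1, hDr x⟩, hmemHi x⟩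
      map_one' := Subtype.ext (by
        show e.symm ⟨((1 : D) : absoluteGaloisGroup K), hDr 1⟩ = 1
        rw [← map_one e.symm]
        rfl)
      map_mul' := fun x y ↦ Subtype.ext (by
        show e.symm ⟨((x * y : D) : absoluteGaloisGroup K), hDr (x * y)⟩ =
          e.symm ⟨(x : absoluteGaloisGroup K), hDr x⟩ * e.symm ⟨(y : absoluteGaloisGroup K), hDr y⟩
        rw [← map_mul e.symm]
        rfl)
      continuous_toFun :=
        (e.symm.continuous.comp (continuous_subtype_val.subtype_mk fun x ↦ hDr x)).subtype_mk
          fun x ↦ hmemHi x }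
  have hθ₂res : ∀ x : D, absGaloisRestrict K Fv (θ₂ x : G) = (x : absoluteGaloisGroup K) := fun x ↦
    absGaloisRestrict_absGaloisRangeEquivCompletion_symm K v ⟨x.1, hDr x⟩
  have hθ₂ : Surjective θ₂ := fun y ↦ ⟨θ₁ y, Subtype.ext (by
    show e.symm ⟨absGaloisRestrict K Fv y, hDr (θ₁ y)⟩ = (y : G)
    have : (⟨absGaloisRestrict K Fv y, hDr (θ₁ y)⟩ : (absGaloisRestrict K Fv).range) = e y :=
      Subtype.ext rfl
    rw [this, ContinuousMulEquiv.symm_apply_apply])⟩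
  -- Step (α): `kerD κ v ≅ D` on `p`-torsion of `H¹(·, E[p^∞])`
  have hα : Nat.card {f : Literature.NumberTheory.EllipticCurves.subgroupH1 (kerD κ v) A // p • f = 0} =
      Nat.card {x : Literature.NumberTheory.EllipticCurves.subgroupH1 D A // p • x = 0} := by
    obtain ⟨ρ, hρ⟩ := exists_injective_subgroupH1_kerD κ (M := A) v
    let θ₃ : kerD κ v →ₜ* D :=
      { toFun := fun x ↦ ⟨((x : decomp (K := K) v) : absoluteGaloisGroup K),
          Subgroup.mem_inf.mpr ⟨(mem_kerD_iff κ v _).1 x.2, (x : decomp (K := K) v).2⟩⟩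
        map_one' := rfl
        map_mul' := fun _ _ ↦ rfl
        continuous_toFun := (continuous_subtype_val.comp continuous_subtype_val).subtype_mk _ }
    have hθ₃ : Surjective θ₃ := fun d ↦
      ⟨⟨⟨(d : absoluteGaloisGroup K), (Subgroup.mem_inf.mp d.2).2⟩,
        (mem_kerD_iff κ v _).2 (Subgroup.mem_inf.mp d.2).1⟩, rfl⟩
    let ρ' := resH1Hom θ₃ (AddMonoidHom.id A) fun x m ↦ (rfl : θ₃ x • m = x • m)
    have hρ' : Injective ρ' := resH1Hom_injective_of_surjective θ₃ hθ₃ fun _ _ ↦ rfl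
    haveI := finite_pTorsion_subgroupH1_kerD W κ hpv hD
    haveI : Finite {x : Literature.NumberTheory.EllipticCurves.subgroupH1 D A // p • x = 0} :=
      (finite_pTorsion_subgroupH1_inf_decomp W κ hpv hD).to_subtype
    refine natCard_eq_of_injective_of_injective
      (f := fun f ↦ ⟨ρ f.1, by rw [← map_nsmul, f.2, map_zero]⟩)
      (g := fun x ↦ ⟨ρ' x.1, by rw [← map_nsmul, x.2, map_zero]⟩) ?_ ?_
    · intro a b h; exact Subtype.ext (hρ (congrArg Subtype.val h))
    · intro a b h; exact Subtype.ext (hρ' (congrArg Subtype.val h))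
  -- Step (β): Kummer `H¹(D, E[p]) ⥲ H¹(D, E[p^∞])[p]`
  have hdiv : ∀ a : A, (∀ g : D, (g : absoluteGaloisGroup K) • a = a) →
      ∃ b : A, (∀ g : D, (g : absoluteGaloisGroup K) • b = b) ∧ p • b = a := by
    intro a ha
    obtain ⟨b, hb, hpb⟩ := exists_fixed_and_nsmul_eq_of_hasGoodReductionAt W κ hpv hns hv
      (a := a) fun h hh ↦ ha (θ₁ ⟨h, hh⟩)
    refine ⟨b, fun g ↦ ?_, hpb⟩
    obtain ⟨y, hy⟩ := hθ₁ g
    rw [← hy]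
    exact hb y y.2
  haveI hfinDA : Finite {x : Literature.NumberTheory.EllipticCurves.subgroupH1 D A // p • x = 0} :=
    (finite_pTorsion_subgroupH1_inf_decomp W κ hpv hD).to_subtype
  have hβ : Nat.card {x : Literature.NumberTheory.EllipticCurves.subgroupH1 D A // p • x = 0} =
      Nat.card (Literature.NumberTheory.EllipticCurves.subgroupH1 D B) := by
    haveI := finite_subgroupH1_inf_decomp_geomTorsion W κ hpv hD
    refine (Nat.card_congr (Equiv.ofBijective (fun y : Literature.NumberTheory.EllipticCurves.subgroupH1 D B ↦
      (⟨W.torsionToPrimaryH1Sub p D y,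
        Literature.NumberTheory.EllipticCurves.FineSelmerCoefficientMap.p_smul_torsionToPrimaryH1Sub_eq_zero
          (W := W) D y⟩ : {x : Literature.NumberTheory.EllipticCurves.subgroupH1 D A // p • x = 0}))
      ⟨?_, ?_⟩)).symm
    · intro y y' h
      have h' : W.torsionToPrimaryH1Sub p D (y - y') = 0 := by
        rw [map_sub, sub_eq_zero]; exact congrArg Subtype.val h
      exact sub_eq_zero.mp
        (Literature.NumberTheory.EllipticCurves.FineSelmerCoefficientMap.eq_zero_of_torsionToPrimaryH1Sub_eq_zero_of_divisible
          W D hdiv _ h')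
    · rintro ⟨x, hx⟩
      obtain ⟨y, hy⟩ := W.exists_torsionToPrimaryH1Sub_eq p W.zsmul_geomPoints_surjective_holds hx
      exact ⟨y, Subtype.ext hy⟩
  -- the local action on `E[p]` (an instance of this proof only), unramified at the good `v`
  letI : DistribMulAction G B := DistribMulAction.compHom _ (absGaloisRestrict K Fv).toMonoidHom
  haveI : ContinuousSMul (absoluteGaloisGroup K) B :=
    WeierstrassCurve.continuousSMul_geomTorsion W (WeierstrassCurve.isOpen_stabilizer_point_holds W) _
  have hcont : ∀ b : B, Continuous fun σ : G ↦ σ • b := fun b ↦ by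
    change Continuous fun σ : G ↦ absGaloisRestrict K Fv σ • b
    exact (continuous_id.smul continuous_const :
      Continuous fun τ : absoluteGaloisGroup K ↦ τ • b).comp (absGaloisRestrict K Fv).continuous_toFun
  haveI : Finite B := finite_torsionPoints_holds W (AlgebraicClosure K) (by exact_mod_cast hp.ne_zero)
  have hB : ∃ k : ℕ, ∀ b : B, p ^ k • b = 0 := ⟨1, fun b ↦ by
    rw [pow_one]
    exact Subtype.ext (by
      rw [AddSubgroupClass.coe_nsmul, ZeroMemClass.coe_zero, ← natCast_zsmul]
      exact (mem_geomTorsion_iff W (p : ℤ) _).mp b.2)⟩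
  have hunr : ∀ σ ∈ absInertia Fv, ∀ b : B, σ • b = b := fun σ hσ b ↦ by
    change absGaloisRestrict K Fv σ • b = b
    have hσ' : absGaloisRestrict K Fv σ ∈ (adicCompletionPrime K v).inertia (absoluteGaloisGroup K) := by
      rw [inertia_adicCompletionPrime_eq_map_absInertia]
      exact Subgroup.mem_map_of_mem _ hσ
    exact W.smul_geomTorsion_eq_of_mem_inertia hv (n := (p : ℤ)) (by exact_mod_cast hpv)
      (adicCompletionPrime_mem_primesAbove K v) hσ' b
  -- Step (δ): `D = res(Hi)` on `H¹(·, E[p])`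
  have hδ : Nat.card (Literature.NumberTheory.EllipticCurves.subgroupH1 D B) =
      Nat.card (Literature.NumberTheory.EllipticCurves.subgroupH1 Hi B) := by
    haveI := finite_subgroupH1_inf_decomp_geomTorsion W κ hpv hD
    have hcard : Nat.card B = p ^ 2 :=
      card_torsionPoints_eq_sq_holds W (AlgebraicClosure K) (by
        haveI : CharZero (AlgebraicClosure K) :=
          charZero_of_injective_algebraMap (algebraMap K (AlgebraicClosure K)).injective
        exact_mod_cast hp.ne_zero)
    haveI := (NonsplitTower.finite_subgroupH1_and_natCard_le κ hpv hns hB (by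
      rw [hcard]
      exact ((Nat.coprime_primes hp (ringChar_residueField_prime (F := Fv))).2
        (Ne.symm (v.ringChar_residueField_adicCompletion_ne hpv))).pow_left 2) hcont).1
    exact natCard_eq_of_injective_of_injective
      (resH1Hom_injective_of_surjective θ₁ hθ₁ fun _ _ ↦ rfl)
      (resH1Hom_injective_of_surjective θ₂ hθ₂ fun x m ↦ by
        change absGaloisRestrict K Fv (θ₂ x : G) • m = (x : absoluteGaloisGroup K) • m
        rw [hθ₂res])
  -- Step (ε): the unramified count
  obtain ⟨R₀, hR₀⟩ := exists_forall_natCard_subgroupH1_localSubgroup_eq κ hpv hns hB hcont hunr hφ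
  refine ⟨R₀, fun R hR ↦ ?_⟩
  rw [hα, hβ, hδ, hR₀ R hR]
  exact Nat.card_congr (Equiv.subtypeEquivRight fun P ↦ Iff.rfl)

end Summit.BirchSwinnertonDyer.BirchSwinnertonDyer.Theorems.UniversalToricDescentGoodLocalTerm

end
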